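import Summits.CriticalPhenomena.SAWScalingLimit.Theorems.EdgeOfPositivity.Negative.EdgeOfPositivityWindow
import Summits.CriticalPhenomena.SAWScalingLimit.Theorems.BoundaryTP2Negative_Midpoints

/-!
# `EdgeOfPositivity` (crux stmt-CriticalPhenomena-11344): exact small-box partition functions; natural strengthenings are false; the ray `x ≥ 0.542`

Negative-lane support file (refuter `cdisprove`, landed copy of §2g–§3 of
`Cruxes/EdgeOfPositivity/Disproof.lean`).  With SOUNDNESS of the path enumerator as well as its
completeness, the fugacity-`x` partition function of any small box equals the weight of a
kernel-computed list (`Zx_box_eq_sum`, `Zx_box_eq_lens`: two `decide`s per polynomial).  Hence,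
as theorems: the smallest admissible domain (the `2 × 2` box) never violates TP₂ strictly and is
tight at `x = 1` (`tight_22`); violation sets of a fixed quadruple are NOT up-sets in the
fugacity (`not_upset_24`: the corners of the `2 × 4` box violate at `x = 1` and satisfy TP₂
strictly at `x = 4`) — thresholds certify nothing above themselves and no proof of the crux can
argue by monotonicity in `x`.  Finally the `BoundaryTP2` seat's `3 × 3` midpoint certificate
(`BoundaryTP2Negative_Midpoints`) is read as a witness of the crux on `(0.5412, 1.3066)`, which
with the `2 × 3` box gives the certified ray `x ≥ 0.542` and the reduction of the crux to the
window `x_c < x < 0.542` (`edgeOfPositivity_iff_window'`).  No Theses statement is asserted.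
-/

noncomputable section

open MeasureTheory Filter Topology Set Function
open Literature.Probability.LatticeModels Literature.Probability.Percolation
open Literature.Probability.RandomPlanarGeometry Literature.Probability.RandomPlanarGeometry.SAW
open scoped ENNReal NNReal

namespace Summit.CriticalPhenomena.SAWScalingLimit.Theorems.EdgeOfPositivity.Negative

open Summit.CriticalPhenomena.SAWScalingLimit.Theses.SAWTotalPositivity

/-! ## §2g Generic certificates: EXACT partition functions of small boxes by kernel evaluation

With soundness of the enumerator as well, `Z_x(u,v)` on any box `{0..a} × {0..b}` equals the
weight of the kernel-computed path list, so every small-box polynomial below is certified by two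
`decide`s (the length multiset of the list, and its repetition-freeness). -/

section DFSsound
variable {α : Type*} [DecidableEq α]

/-- The last vertex of the list `cur :: rest` (structural recursion, for dependent typing). [folklore] -/
def lastOf : α → List α → α
  | cur, [] => cur
  | _, w :: rest => lastOf w rest

/-- **Soundness of the enumerator.** Every produced list is `cur :: rest` with `rest` following
`nbr`, repetition-free, avoiding `vis`, and ending at `tgt`. [folklore] -/
theorem allPaths_sound (nbr : α → List α) (tgt : α) :
    ∀ (fuel : ℕ) (cur : α) (vis L : List α), L ∈ allPaths nbr tgt fuel cur vis →
      ∃ rest, L = cur :: rest ∧ Follows nbr cur rest ∧ (cur :: rest).Nodup ∧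
        (∀ w ∈ rest, w ∉ vis) ∧ lastOf cur rest = tgt := by
  intro fuel
  induction fuel with
  | zero =>
    intro cur vis L hL
    unfold allPaths at hL
    split_ifs at hL with h
    · simp only [List.mem_singleton] at hL
      exact ⟨[], hL, trivial, List.nodup_singleton _, fun w hw => absurd hw List.not_mem_nil, h⟩
    · exact absurd hL List.not_mem_nil
  | succ fuel ih =>
    intro cur vis L hL
    unfold allPaths at hL
    split_ifs at hL with h
    · simp only [List.mem_singleton] at hL
      exact ⟨[], hL, trivial, List.nodup_singleton _, fun w hw => absurd hw List.not_mem_nil, h⟩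
    · rw [List.mem_flatMap] at hL
      obtain ⟨w, hw, hL⟩ := hL
      rw [List.mem_filter] at hw
      obtain ⟨hwn, hw2⟩ := hw
      simp only [decide_eq_true_eq] at hw2
      rw [List.mem_map] at hL
      obtain ⟨L', hL', rfl⟩ := hL
      obtain ⟨rest', rfl, hf, hnd, hvis, hlast⟩ := ih w (cur :: vis) L' hL'
      refine ⟨w :: rest', rfl, ⟨hwn, hf⟩, ?_, ?_, hlast⟩
      · rw [List.nodup_cons]
        refine ⟨?_, hnd⟩
        rw [List.mem_cons, not_or]
        exact ⟨fun h' => hw2.2 h'.symm, fun h' => (hvis cur h') List.mem_cons_self⟩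
      · intro u hu
        rw [List.mem_cons] at hu
        rcases hu with rfl | hu
        · exact hw2.1
        · exact fun h' => hvis u hu (List.mem_cons_of_mem _ h')

end DFSsound

section walkOf
variable {V : Type*} {G : SimpleGraph V} (nbr : V → List V) (S : Set V)
  (hadj : ∀ a b, a ∈ S → b ∈ nbr a → G.Adj a b) (hS : ∀ a b, a ∈ S → b ∈ nbr a → b ∈ S)

/-- The walk with support `cur :: rest`, for `rest` following neighbour lists whose entries are
graph neighbours inside the invariant set `S`. [folklore] -/
def walkOf : ∀ (cur : V) (rest : List V), cur ∈ S → Follows nbr cur rest → G.Walk cur (lastOf cur rest)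
  | _, [], _, _ => .nil
  | cur, w :: rest, hc, h => .cons (hadj cur w hc h.1) (walkOf w rest (hS cur w hc h.1) h.2)

/-- The support of `walkOf` is the given list. [folklore] -/
theorem support_walkOf : ∀ (cur : V) (rest : List V) (hc : cur ∈ S) (h : Follows nbr cur rest),
    (walkOf nbr S hadj hS cur rest hc h).support = cur :: rest
  | _, [], _, _ => rfl
  | cur, w :: rest, hc, h => by
    show (SimpleGraph.Walk.cons _ (walkOf nbr S hadj hS w rest (hS cur w hc h.1) h.2)).support = _
    rw [SimpleGraph.Walk.support_cons]
    exact congrArg (cur :: ·) (support_walkOf w rest (hS cur w hc h.1) h.2)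

end walkOf

/-- All sites of the box `{0..a} × {0..b}`, as a list. [folklore] -/
def boxList (a b : ℕ) : List (Site 2) :=
  (List.range (a + 1)).flatMap fun i : ℕ => (List.range (b + 1)).map fun j : ℕ => st (i : ℤ) (j : ℤ)

/-- The box list enumerates exactly the sites of the box. [folklore] -/
theorem mem_boxList_iff {a b : ℕ} {v : Site 2} : v ∈ boxList a b ↔ v ∈ rectSites a b := by
  simp only [boxList, List.mem_flatMap, List.mem_range, List.mem_map, mem_rectSites_iff]
  constructor
  · rintro ⟨i, hi, j, hj, rfl⟩
    simp only [st_zero, st_one]; omega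
  · rintro ⟨⟨h0, h0'⟩, h1, h1'⟩
    refine ⟨(v 0).toNat, by omega, (v 1).toNat, by omega, ?_⟩
    rw [show ((v 0).toNat : ℤ) = v 0 from Int.toNat_of_nonneg h0,
      show ((v 1).toNat : ℤ) = v 1 from Int.toNat_of_nonneg h1, st_eta]

/-- The box list has `(a+1)(b+1)` entries. [folklore] -/
theorem length_boxList (a b : ℕ) : (boxList a b).length = (a + 1) * (b + 1) := by
  simp [boxList, List.length_flatMap, List.map_const', List.sum_replicate]

/-- Neighbour lists of the box: the sites of the box lattice-adjacent to `v`. [folklore] -/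
def nbrBox (a b : ℕ) (v : Site 2) : List (Site 2) := (boxList a b).filter fun w => (zdGraph 2).Adj v w

/-- Membership in the box neighbour lists. [folklore] -/
theorem mem_nbrBox_iff {a b : ℕ} {v w : Site 2} : w ∈ nbrBox a b v ↔ w ∈ rectSites a b ∧ (zdGraph 2).Adj v w := by
  simp [nbrBox, List.mem_filter, mem_boxList_iff]

/-- COMPLETENESS of the neighbour lists for `R_1`. [folklore] -/
theorem mem_nbrBox_of_adj {a b : ℕ} (v w : Site 2) (h : (discreteDomainGraph (rectDomain a b) 1).Adj v w) :
    w ∈ nbrBox a b v :=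
  mem_nbrBox_iff.2 ⟨(adj_rect_iff.1 h).2.2, (adj_rect_iff.1 h).1⟩

/-- SOUNDNESS of the neighbour lists for `R_1` (from a site of the box). [folklore] -/
theorem adj_of_mem_nbrBox {a b : ℕ} (v w : Site 2) (hv : v ∈ rectSites a b) (h : w ∈ nbrBox a b v) :
    (discreteDomainGraph (rectDomain a b) 1).Adj v w :=
  adj_rect_iff.2 ⟨(mem_nbrBox_iff.1 h).2, hv, (mem_nbrBox_iff.1 h).1⟩

/-- The neighbour lists stay in the box. [folklore] -/
theorem mem_rectSites_of_mem_nbrBox {a b : ℕ} (v w : Site 2) (_hv : v ∈ rectSites a b) (h : w ∈ nbrBox a b v) :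
    w ∈ rectSites a b :=
  (mem_nbrBox_iff.1 h).1

/-- The kernel-evaluable list of all supports of SAWs `u → v` of the box. [folklore] -/
def boxPaths (a b : ℕ) (u v : Site 2) : List (List (Site 2)) :=
  allPaths (nbrBox a b) v ((a + 1) * (b + 1) - 1) u []

/-- **Exhaustion (generic).** The support of every SAW of the box from a site `u` is in `boxPaths`.
[folklore] -/
theorem support_mem_boxPaths {a b : ℕ} {u v : Site 2} (hu : u ∈ rectSites a b)
    (γ : DomainSAW (rectDomain a b) 1 u v) : γ.walk.support ∈ boxPaths a b u v := by
  have hsup : γ.walk.support = u :: γ.walk.support.tail := (γ.walk.cons_tail_support).symm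
  rw [boxPaths, hsup]
  apply mem_allPaths
  · exact follows_support_tail (nbrBox a b) mem_nbrBox_of_adj γ.walk
  · rw [← hsup]; exact γ.isPath.support_nodup
  · intro w _; exact List.not_mem_nil
  · have h1 : (u :: γ.walk.support.tail).getLast (List.cons_ne_nil _ _) =
        γ.walk.support.getLast γ.walk.support_ne_nil := by
      congr 1; exact hsup.symm
    rw [h1, SimpleGraph.Walk.getLast_support]
  · have hsub : γ.walk.support ⊆ boxList a b := fun w hw =>
      mem_boxList_iff.2 (support_subset_rectSites hu γ.walk w hw)
    have hlen : γ.walk.support.length ≤ (boxList a b).length :=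
      (List.subperm_of_subset γ.isPath.support_nodup hsub).length_le
    rw [length_boxList] at hlen
    have : (u :: γ.walk.support.tail).length ≤ (a + 1) * (b + 1) := by rw [← hsup]; exact hlen
    rw [List.length_cons] at this
    omega

/-- The SAW of the box whose support is a given member of `boxPaths`. [folklore] -/
def sawOfMem {a b : ℕ} {u v : Site 2} (hu : u ∈ rectSites a b) {L : List (Site 2)}
    (hL : L ∈ boxPaths a b u v) : DomainSAW (rectDomain a b) 1 u v :=
  have h := allPaths_sound (nbrBox a b) v _ u [] L hL
  ⟨(walkOf (nbrBox a b) (rectSites a b) adj_of_mem_nbrBox mem_rectSites_of_mem_nbrBox u h.choose hu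
      h.choose_spec.2.1).copy rfl h.choose_spec.2.2.2.2,
    SimpleGraph.Walk.IsPath.mk' (by
      rw [SimpleGraph.Walk.support_copy, support_walkOf]
      exact h.choose_spec.2.2.1)⟩

/-- `sawOfMem` has the prescribed support. [folklore] -/
theorem support_sawOfMem {a b : ℕ} {u v : Site 2} (hu : u ∈ rectSites a b) {L : List (Site 2)}
    (hL : L ∈ boxPaths a b u v) : (sawOfMem hu hL).walk.support = L := by
  have h := allPaths_sound (nbrBox a b) v _ u [] L hL
  show ((walkOf (nbrBox a b) (rectSites a b) adj_of_mem_nbrBox mem_rectSites_of_mem_nbrBox u h.choose hu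
      h.choose_spec.2.1).copy rfl h.choose_spec.2.2.2.2).support = L
  rw [SimpleGraph.Walk.support_copy, support_walkOf]
  exact h.choose_spec.1.symm

/-- **EXACT PARTITION FUNCTIONS OF BOXES.** `Z_x(u,v) = Σ_{L ∈ boxPaths} x^{|L|-1}`. [folklore] -/
theorem Zx_box_eq_sum {a b : ℕ} (x : ℝ) {u v : Site 2} (hu : u ∈ rectSites a b) :
    Zx x (rectDomain a b) 1 u v = ∑ L ∈ (boxPaths a b u v).toFinset, listWeight x L := by
  refine le_antisymm (Zx_le_sum_of_supports x _ fun γ => List.mem_toFinset.2 (support_mem_boxPaths hu γ)) ?_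
  let S := (boxPaths a b u v).toFinset
  let f : ↥S → DomainSAW (rectDomain a b) 1 u v := fun L => sawOfMem hu (List.mem_toFinset.1 L.2)
  have hf : Injective f := by
    intro L L' h
    have h' := congrArg (fun γ : DomainSAW (rectDomain a b) 1 u v => γ.walk.support) h
    simp only [f, support_sawOfMem] at h'
    exact Subtype.ext h'
  calc ∑ L ∈ S, listWeight x L = ∑' L : ↥S, listWeight x L.1 := by rw [tsum_fintype, Finset.sum_coe_sort]
    _ = ∑' L : ↥S, (fun γ : DomainSAW (rectDomain a b) 1 u v => ENNReal.ofReal (x ^ γ.length)) (f L) := by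
        congr 1; funext L
        show listWeight x L.1 = ENNReal.ofReal (x ^ (sawOfMem hu (List.mem_toFinset.1 L.2)).length)
        rw [← listWeight_support x, support_sawOfMem]
    _ ≤ Zx x (rectDomain a b) 1 u v := ENNReal.tsum_comp_le_tsum_of_injective hf _

/-- **POLYNOMIAL FORM.** If the multiset of lengths of `boxPaths` is `lens` (a `decide`), then
`Z_x(u,v) = Σ_{n ∈ lens} x^n`. [folklore] -/
theorem Zx_box_eq_lens {a b : ℕ} (x : ℝ) {u v : Site 2} (hu : u ∈ rectSites a b) (lens : List ℕ)
    (hnd : (boxPaths a b u v).Nodup)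
    (hperm : ((boxPaths a b u v).map fun L => L.length - 1).Perm lens) :
    Zx x (rectDomain a b) 1 u v = (lens.map fun n => ENNReal.ofReal (x ^ n)).sum := by
  rw [Zx_box_eq_sum x hu, List.sum_toFinset _ hnd, ← (hperm.map fun n => ENNReal.ofReal (x ^ n)).sum_eq,
    List.map_map]
  rfl

/-! ## §3 Natural strengthenings are FALSE; the smallest domain is TIGHT

§3a  The `2 × 2` box (the smallest domain with an admissible quadruple — its four corners) NEVER
violates TP₂ strictly: `Z₁₃Z₂₄ − Z₁₂Z₃₄ = 4x⁴ − (x+x³)² = −x²(1−x²)² ≤ 0`, with EQUALITY exactly at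
`x = 1`.  So "every admissible quadruple of every domain eventually violates" is false, and the
TP₂ inequality is tight (not strict) in the supercritical regime.
§3b  NOT AN UP-SET: at the four corners of the `2 × 4` box the left-pair/right-pair inequality is
violated at `x = 1` (`16 < 64`) but HOLDS again at `x = 4` (`257·… > 256·…`; exactly on
`(0.66963, 3.98423)`, the roots of `x⁴ − 4x³ + 1`).  A threshold `x₀(Ω)` therefore certifies
nothing above itself; certificates for the crux must be unions of violation sets, and a proof
cannot argue by monotonicity in `x`. -/

/-- Sites `(0,0)`, `(1,0)` of any box. [folklore] -/
theorem st_mem_rectSites {a b : ℕ} {i j : ℕ} (hi : i ≤ a) (hj : j ≤ b) : st i j ∈ rectSites a b := by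
  simp [mem_rectSites_iff]; omega

/-- `Z_x((0,0),(1,0)) = Z_x((1,1),(0,1)) = x + x³` and `Z_x((0,0),(1,1)) = Z_x((1,0),(0,1)) = 2x²`
on the `2 × 2` box. [folklore] -/
theorem Z22_values (x : ℝ) :
    Zx x (rectDomain 1 1) 1 (st 0 0) (st 1 0) = ENNReal.ofReal (x ^ 1) + ENNReal.ofReal (x ^ 3) ∧
    Zx x (rectDomain 1 1) 1 (st 1 1) (st 0 1) = ENNReal.ofReal (x ^ 1) + ENNReal.ofReal (x ^ 3) ∧
    Zx x (rectDomain 1 1) 1 (st 0 0) (st 1 1) = ENNReal.ofReal (x ^ 2) + ENNReal.ofReal (x ^ 2) ∧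
    Zx x (rectDomain 1 1) 1 (st 1 0) (st 0 1) = ENNReal.ofReal (x ^ 2) + ENNReal.ofReal (x ^ 2) := by
  have h00 : st 0 0 ∈ rectSites 1 1 := st_mem_rectSites (i := 0) (j := 0) (by omega) (by omega)
  have h11 : st 1 1 ∈ rectSites 1 1 := st_mem_rectSites (i := 1) (j := 1) (by omega) (by omega)
  have h10 : st 1 0 ∈ rectSites 1 1 := st_mem_rectSites (i := 1) (j := 0) (by omega) (by omega)
  refine ⟨?_, ?_, ?_, ?_⟩
  · rw [Zx_box_eq_lens x h00 [1, 3] (by decide) (by decide)]; simp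
  · rw [Zx_box_eq_lens x h11 [1, 3] (by decide) (by decide)]; simp
  · rw [Zx_box_eq_lens x h00 [2, 2] (by decide) (by decide)]; simp
  · rw [Zx_box_eq_lens x h10 [2, 2] (by decide) (by decide)]; simp

/-- **§3a TIGHTNESS ON THE SMALLEST DOMAIN.** At the corners `p₁=(0,0), p₂=(1,0), p₃=(1,1),
p₄=(0,1)` of the `2 × 2` box, for EVERY fugacity `x ≥ 0` the crossing product does not exceed
the non-crossing one (`4x⁴ ≤ (x+x³)²`, AM–GM), with equality at `x = 1`: TP₂ holds but is not
strict in the supercritical regime, and this admissible quadruple never witnesses the crux.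
[folklore] -/
theorem tight_22 :
    (∀ x : ℝ, 0 ≤ x →
      Zx x (rectDomain 1 1) 1 (st 0 0) (st 1 1) * Zx x (rectDomain 1 1) 1 (st 1 0) (st 0 1) ≤
        Zx x (rectDomain 1 1) 1 (st 0 0) (st 1 0) * Zx x (rectDomain 1 1) 1 (st 1 1) (st 0 1)) ∧
    Zx 1 (rectDomain 1 1) 1 (st 0 0) (st 1 1) * Zx 1 (rectDomain 1 1) 1 (st 1 0) (st 0 1) =
      Zx 1 (rectDomain 1 1) 1 (st 0 0) (st 1 0) * Zx 1 (rectDomain 1 1) 1 (st 1 1) (st 0 1) := by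
  constructor
  · intro x hx
    obtain ⟨h1, h2, h3, h4⟩ := Z22_values x
    rw [h1, h2, h3, h4, ← ENNReal.ofReal_add (by positivity) (by positivity),
      ← ENNReal.ofReal_add (by positivity) (by positivity), ← ENNReal.ofReal_mul (by positivity),
      ← ENNReal.ofReal_mul (by positivity)]
    apply ENNReal.ofReal_le_ofReal
    nlinarith [sq_nonneg (x - x ^ 3), pow_nonneg hx 2]
  · obtain ⟨h1, h2, h3, h4⟩ := Z22_values 1
    rw [h1, h2, h3, h4]; norm_num

/-- Exact corner partition functions of the `2 × 4` box: `Z(bl,tl) = Z(tr,br) = x+x³+x⁵+x⁷`,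
`Z(bl,tr) = Z(tl,br) = 4x⁴+4x⁶`. [folklore] -/
theorem Z24_values (x : ℝ) :
    Zx x (rectDomain 3 1) 1 (st 0 0) (st 0 1) = ([1, 3, 5, 7].map fun n => ENNReal.ofReal (x ^ n)).sum ∧
    Zx x (rectDomain 3 1) 1 (st 3 1) (st 3 0) = ([1, 3, 5, 7].map fun n => ENNReal.ofReal (x ^ n)).sum ∧
    Zx x (rectDomain 3 1) 1 (st 0 0) (st 3 1) = ([4, 4, 4, 4, 6, 6, 6, 6].map fun n => ENNReal.ofReal (x ^ n)).sum ∧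
    Zx x (rectDomain 3 1) 1 (st 0 1) (st 3 0) = ([4, 4, 4, 4, 6, 6, 6, 6].map fun n => ENNReal.ofReal (x ^ n)).sum := by
  have h00 : st 0 0 ∈ rectSites 3 1 := st_mem_rectSites (i := 0) (j := 0) (by omega) (by omega)
  have h31 : st 3 1 ∈ rectSites 3 1 := st_mem_rectSites (i := 3) (j := 1) (by omega) (by omega)
  have h01 : st 0 1 ∈ rectSites 3 1 := st_mem_rectSites (i := 0) (j := 1) (by omega) (by omega)
  exact ⟨Zx_box_eq_lens x h00 _ (by decide) (by decide), Zx_box_eq_lens x h31 _ (by decide) (by decide),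
    Zx_box_eq_lens x h00 _ (by decide) (by decide), Zx_box_eq_lens x h01 _ (by decide) (by decide)⟩

/-- **§3b VIOLATION SETS ARE NOT UP-SETS.** At the corners `p₁=bl=(0,0), p₂=tl=(0,1), p₃=tr=(3,1),
p₄=br=(3,0)` of the `2 × 4` box (interlaced crossing `(p₁p₃|p₂p₄)`), TP₂ `Z₁₂Z₃₄ ≥ Z₁₃Z₂₄`
FAILS at `x = 1` but HOLDS STRICTLY at `x = 4`. [folklore] -/
theorem not_upset_24 :
    Zx 1 (rectDomain 3 1) 1 (st 0 0) (st 0 1) * Zx 1 (rectDomain 3 1) 1 (st 3 1) (st 3 0) <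
      Zx 1 (rectDomain 3 1) 1 (st 0 0) (st 3 1) * Zx 1 (rectDomain 3 1) 1 (st 0 1) (st 3 0) ∧
    Zx 4 (rectDomain 3 1) 1 (st 0 0) (st 3 1) * Zx 4 (rectDomain 3 1) 1 (st 0 1) (st 3 0) <
      Zx 4 (rectDomain 3 1) 1 (st 0 0) (st 0 1) * Zx 4 (rectDomain 3 1) 1 (st 3 1) (st 3 0) := by
  constructor
  · obtain ⟨h1, h2, h3, h4⟩ := Z24_values 1
    rw [h1, h2, h3, h4]; norm_num
  · obtain ⟨h1, h2, h3, h4⟩ := Z24_values 4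
    rw [h1, h2, h3, h4]
    norm_num [← ENNReal.ofReal_add, ← ENNReal.ofReal_mul]


/-! ### §3c Cross-certificate with the `BoundaryTP2` seat: the `3 × 3` midpoints, window `0.542`

The standing disprover of `BoundaryTP2` (stmt-7115) certified the edge-midpoint quadruple
`A=(0,1), B=(1,0), C=(2,1), D=(1,2)` of the `3 × 3` box (`BoundaryTP2Negative_Midpoints`:
admissible; `Z(A,C) = Z(B,D) = x²+6x⁴+2x⁶`, `Z(A,B) = Z(C,D) = 2x²+2x⁴+4x⁶`), which violates TP₂
exactly for `x² ∈ (1 − √2/2, 1 + √2/2)`, i.e. `x ∈ (0.54120, 1.30656)` — again NOT an up-set.  Its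
`Z₃` is definitionally our `Zx · Ω₃ 1`, so it is a witness of `EdgeOfPositivityAt x` on that
window, and together with the `2 × 3` box the certified ray becomes `x ≥ 0.542`. -/

open Summit.CriticalPhenomena.SAWScalingLimit.Theorems.BoundaryTP2.Negative in
/-- The `3 × 3` midpoint quadruple witnesses the crux at every `x > 0` with `1 + 2x⁴ < 4x²`
(`0.5412 < x < 1.3066`). [folklore] -/
theorem edgeOfPositivityAt_of_midpoints {x : ℝ} (hx : 0 < x) (h : 1 + 2 * x ^ 4 < 4 * x ^ 2) :
    EdgeOfPositivityAt x := by
  refine ⟨Ω₃, 1, ![0, 1], ![1, 0], ![2, 1], ![1, 2], isBounded_Ω₃, simplyConnectedSpace_Ω₃, one_pos,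
    midpoints_interlaced, midpoints_D1, midpoints_D2, ?_⟩
  show Z₃ x ![0, 1] ![1, 0] * Z₃ x ![2, 1] ![1, 2] < Z₃ x ![0, 1] ![2, 1] * Z₃ x ![1, 0] ![1, 2]
  rw [Z₃_01_21 hx.le, Z₃_10_12 hx.le, Z₃_01_10 hx.le, Z₃_21_12 hx.le, ← ENNReal.ofReal_mul, ← ENNReal.ofReal_mul,
    ENNReal.ofReal_lt_ofReal_iff]
  · simp only [List.map_cons, List.map_nil, List.sum_cons, List.sum_nil, add_zero]
    have h2 := pow_pos hx 2; have h4 := pow_pos hx 4; have h6 := pow_pos hx 6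
    have hkey : 2 * x ^ 2 + 2 * x ^ 4 + 4 * x ^ 6 < x ^ 2 + 6 * x ^ 4 + 2 * x ^ 6 := by nlinarith [mul_pos h2 (sub_pos.2 h)]
    have hA : 0 < 2 * x ^ 2 + 2 * x ^ 4 + 4 * x ^ 6 := by positivity
    nlinarith [mul_lt_mul'' hkey hkey hA.le hA.le]
  · simp only [List.map_cons, List.map_nil, List.sum_cons, List.sum_nil, add_zero]
    positivity
  · simp only [List.map_cons, List.map_nil, List.sum_cons, List.sum_nil, add_zero]
    positivity
  · simp only [List.map_cons, List.map_nil, List.sum_cons, List.sum_nil, add_zero]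
    positivity

/-- **THE CERTIFIED RAY `x ≥ 0.542`** (two domains: the `3 × 3` midpoints below `0.551`, the
`2 × 3` box above). [folklore] -/
theorem edgeOfPositivityAt_of_ge' {x : ℝ} (hx : 0.542 ≤ x) : EdgeOfPositivityAt x := by
  by_cases hlt : x < 0.551
  · have hx0 : 0 < x := by linarith
    apply edgeOfPositivityAt_of_midpoints hx0
    -- `f(x) = 4x² − 2x⁴ − 1` is increasing on `[0.542, 0.551]` and `f(0.542) > 0`
    have ha : (0.542 : ℝ) ^ 2 ≤ x ^ 2 := by nlinarith
    have hb : x ^ 2 ≤ (0.551 : ℝ) ^ 2 := by nlinarith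
    have hprod : 0 ≤ (x ^ 2 - 0.542 ^ 2) * (4 - 2 * (x ^ 2 + 0.542 ^ 2)) :=
      mul_nonneg (by linarith) (by nlinarith)
    nlinarith [hprod]
  · exact edgeOfPositivityAt_of_ge (not_lt.1 hlt)

/-- **REDUCTION TO THE WINDOW `(x_c, 0.542)`.** [folklore] -/
theorem edgeOfPositivity_iff_window' :
    EdgeOfPositivity ↔ ∀ x : ℝ, criticalFugacity < x → x < 0.542 → EdgeOfPositivityAt x := by
  rw [edgeOfPositivity_iff]
  refine ⟨fun h x hx _ => h x hx, fun h x hx => ?_⟩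
  by_cases hlt : x < 0.542
  · exact h x hx hlt
  · exact edgeOfPositivityAt_of_ge' (not_lt.1 hlt)

end Summit.CriticalPhenomena.SAWScalingLimit.Theorems.EdgeOfPositivity.Negative
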